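/-
Copyright (c) 2026 the pub-hodgecm-mathlib formalisation cell (harness21).  Prover seat hodgecm-mathlib-LH4-p01 (g0): line LH4 (closer stub `stub_N6ns`, germ road
«N6nsGerm» ED. 1.16″), LEAD F0P3a-plan (g13) T12-7 ∕ T12-9 (1) «BY NAME statements file»; desk of record F0P3-plan (g13) D55-pre (E); 2026-09-02.
-/
import Literature.NumberTheory.Rogawski1990.LocalTransferIdentityCoreThreeWaySplit   -- ★ p847670 (F0P3b-p01 (g14)): `n6nsS3id_of_tameRamAntidiag_of_dyadic_of_shalikaAntidiag` (the three binder TEXTS named here)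
import HarnessLib

/-!
# [Rogawski1990 §4.9 Prop. 4.9.1 (a) p. 55; §8.1 Prop. 8.1.1 p. 112] [LanglandsShelstad1990Descent (2.1.2)] The THREE RESIDUALS of the identity core
# `stub_N6nsS3id` as CLOSED CONSTANTS — «S3-ram at `Φ₃`», «DYADIC», «Shalika at `Φ₃`» — and the three-way split re-exported over them

Topic `NumberTheory/Rogawski1990`; namespace `Literature.NumberTheory.Rogawski1990`.  STATEMENT FILE in the theorems lane: three CLOSED `def … : Prop` (K9β convention:
explicit binders, fully-qualified constants, no instance, no notation, no `sorry`, no `axiom`) whose bodies are the three hypothesis TYPES `hram` ∕ `hdy` ∕ `hsh` of ★ p847670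
`n6nsS3id_of_tameRamAntidiag_of_dyadic_of_shalikaAntidiag` (`LocalTransferIdentityCoreThreeWaySplit.lean` :63–:84 ∕ :85–:121 ∕ :122–:123) BYTE-FOR-BYTE (binder name and outer
parenthesis removed, nothing else; same `open` lines as the ★ file, so the texts elaborate to the same terms), each with its `Iff.rfl` unfolding — a STATEMENTS-ONLY file (defs + `Iff.rfl`, statement lane); the ONE-LINE re-export of the ★ split over the constants,
`n6nsS3id_of_statements` (the `def`s unfold by `delta`; the term is the ★ theorem applied to the three hypotheses, unchanged), is the sibling PROOF file
`LocalTransferIdentityCoreResidualStatementsSplit.lean` (same seat, filed the minute this one lands).  Cell `pub/hodgecm-mathlib` (D-0151), crux H413 =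
`stmt-HodgeConjecture-24833`; line LH4 = the germ road «N6nsGerm» of the closer stub `stub_N6ns` (`Cruxes/H413/Lines/F0_U3LettersRung1.lean` ED. 38 «PK-ε»); LEAD F0P3a-plan
(g13) T12-7 («the later closer ED. 39 §2‴ swap reads the two IN rows BY NAME: `stub_N6nsDyadic : ….N6nsDyadicStatement`, `stub_N6nsShalika : ….N6nsShalikaStatement`; registry
strings = one constant each») ∕ T12-9 (1) (this file, dealt to LH4-p01); desk of record F0P3-plan (g13) D55-pre (E) (price of record 7 → 8, §2‴ «N6ns ⟸ DYADIC · Shalika(Φ₃)»,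
NOT BEFORE the fold closes «S3-ram» and a sorry-free H-FORM head exists — F0P3b-p01 (g14) re-points that head over these constants).

THE THREE RESIDUALS (what each constant SAYS; print basis).  At a finite place `v` of `L⁺` NON-SPLIT in the CM field `L` (one place `w ∣ v`), the identity core of the
Langlands–Shelstad transfer for `(U(3), U(1,1) × U(1))` — «`R_φ` is a stable orbital integral NEAR `γH = 1`» [LanglandsShelstad1990Descent (2.1.2)], the `stub_N6nsS3id` text of
the germ line — splits three ways (★ p847670: `v ∣ 2` → DYADIC; `v ∤ 2` unramified → ★ `s3id_of_shalikaAntidiag` needs only SHALIKA; `v ∤ 2` ramified → frame ★ (H2) + descent ★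
`s3id_descent_of_formCongr` over S3-RAM at `Φ₃`):
* `N6nsS3ramStatement` — «S3-RAM AT `Φ₃`»: at a TAMELY RAMIFIED non-split `v` (`e(w|v) ≠ 1`, `2 ∈ 𝒪_w^×`), for the quasi-split form `Φ₃ = antidiag(1,1,1)`, canonical
  families and the explicit factor `Δ‴_v` under the μ-guard, GIVEN the Shalika germ expansion for `U(Φ₃)(L⁺_v)`: every `φ₃ ∈ C_c^∞` has a local transfer near `1`.  IN-HOUSE
  PAYABLE: it is the contract of the HOME fold «S3-ram» (`LocalTransferAtOneTameRamified.fold`, v7.8: sockets (J★), (Opp) × 2, (Cnt2′) × 2) — the fold's ★ head closes it by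
  `exact`.  [Rogawski1990 §4.9 Prop. 4.9.1 (a) p. 55 («the existence of `f^H` in the p-adic case is contained in [LS₂]»); §8.1 pp. 112–114]
* `N6nsDyadicStatement` — «DYADIC»: the `stub_N6nsS3id` text VERBATIM with the extra hypothesis «`2 ∉ 𝒪_w^×` for every `w ∣ v`» (the place is dyadic) — the PERMANENT PRINT
  residual [LS₂] = [LanglandsShelstad1990Descent (2.1.2)] at `v ∣ 2`, any hermitian anisotropic `H′`.  [Rogawski1990 §4.9 Prop. 4.9.1 (a) p. 55] [LanglandsShelstad1990Descent §2.1 (2.1.2)]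
* `N6nsShalikaStatement` — «SHALIKA AT `Φ₃`»: ★ def `ShalikaGermExpansionNonsplit L Φ₃ v` at every non-split `v` — Harish-Chandra's ∕ Shalika's germ expansion at the identity
  for the quasi-split `U(Φ₃)(L⁺_v)`, PRINT [Rogawski1990 §8.1 Prop. 8.1.1 p. 112] (its printed scope: any p-adic field, no parity proviso).
* (sibling file) `n6nsS3id_of_statements : N6nsS3ramStatement → N6nsDyadicStatement → N6nsShalikaStatement → ‹stub_N6nsS3id text›` = ★ p847670 over the constants.

HONEST LABEL: HC_CM is proved only modulo the 7 printed citations (2 remaining named inputs: hLiu418 = stmt-HodgeConjecture-24832, h413 = stmt-HodgeConjecture-24833) until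
rung 0 closes.  This file NAMES three statements; it discharges nothing: a consumer taking `(h : N6nsDyadicStatement)` or `(h : N6nsShalikaStatement)`
is CONDITIONAL on [LS₂] at the dyadic places ∕ on [Rogawski1990 Prop. 8.1.1]; `N6nsS3ramStatement` is an in-house socket, open until the fold is ★.  Books: count-neutral
(nothing registered here; the germ ED. 1.16″ ∕ closer ED. 39 editions carry the rows — desk's and director's digits).

## References
* [Rogawski1990] J. D. Rogawski, *Automorphic Representations of Unitary Groups in Three Variables*, Ann. of Math. Stud. 123 (1990): §4.9 Prop. 4.9.1 (a) p. 55; §8.1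
  Props. 8.1.1–8.1.2 pp. 112–114; §14.4 p. 237.
* [LanglandsShelstad1990Descent] R. P. Langlands, D. Shelstad, *Descent for transfer factors*, The Grothendieck Festschrift II, Progr. Math. 87 (1990): §2.1 (2.1.2), Lemma
  2.2.A, Thm. 2.3.A.
* [LanglandsShelstad1989] R. P. Langlands, D. Shelstad, *Orbital integrals on forms of SL(3), II*, Canad. J. Math. 41 (1989): Theorem (end of §2, p. 484) (= [LS₂]).
* [HarishChandra1999AdmissibleDistributions] Harish-Chandra (DeBacker–Sally), *Admissible Invariant Distributions on Reductive p-adic Groups*, ULECT 16 (1999): Thm. 8.1 p. 48.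
-/

open NumberField IsDedekindDomain MeasureTheory Measure Topology Filter
open Literature.NumberTheory.Rogawski1990 Literature.NumberTheory.Automorphic Literature.NumberTheory.GaloisRepresentations
open Literature.NumberTheory.Automorphic.UnitaryGroup Literature.NumberTheory.Automorphic.IntegralReduction
open Literature.AlgebraicGeometry.ShimuraVarieties (unitaryGroup hermForm)
open scoped Matrix MatrixGroups Classical ValuativeRel

namespace Literature.NumberTheory.Rogawski1990

/-! ## §1 The three residual statements as closed constants (texts = ★ p847670's binders `hram` ∕ `hdy` ∕ `hsh` byte-for-byte) -/

/-- **«S3-RAM AT `Φ₃`» — the identity core of local `Δ‴_v`-transfer at a TAMELY RAMIFIED non-split place, for the quasi-split form `Φ₃`, GIVEN the Shalika germ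
expansion** (= the `hram` binder of ★ `n6nsS3id_of_tameRamAntidiag_of_dyadic_of_shalikaAntidiag` byte-for-byte): for a CM field `L`, a Hecke character `μ` (unitary, μ-guard
`μ|_{𝕀_{L⁺}} = ω_{L∕L⁺}`), a non-split place `v` with `w ∣ v`, `c • w = w`, `e(w|v) ≠ 1` and `2 ∈ 𝒪_w^×`, Borel σ-algebras, Haar measures, CANONICAL orbital families `mH`, `mG₃` on
`H_v = U(1,1) × U(1)` and `G′_v = U(Φ₃)(L⁺_v)`, and `ShalikaGermExpansionNonsplit L Φ₃ v`: every `φ₃ ∈ C_c^∞(G′_v)` admits `V ∈ 𝓝 1` and `φH ∈ C_c^∞(H_v)` with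
`SO_{γH}(φH) = Σ_c Δ‴_v(γH, c)·O_c(φ₃)` for all `G`-regular `γH ∈ V`.  IN-HOUSE PAYABLE (the HOME fold «S3-ram» closes it by `exact`); print basis: [LS₂] via Rogawski.
[cite: Rogawski1990, §4.9 Prop. 4.9.1 (a) p. 55; §8.1 Props. 8.1.1–8.1.2 pp. 112–114] [cite: LanglandsShelstad1990Descent, §2.1 (2.1.2)] -/
def N6nsS3ramStatement : Prop :=
    ∀ (L : Type) [Field L] [NumberField L] [IsCMField L] (μ : HeckeCharacter L)
      {v : HeightOneSpectrum (𝓞 ↥(maximalRealSubfield L))} (w : UnitaryGroup.PlacesOver L v)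
      (_hw : IsCMField.complexConj L • w.1 = w.1) (_he : v.asIdeal.ramificationIdx' w.1.asIdeal ≠ 1)
      (_hμu : μ.IsUnitary)
      (_hμω : ∀ x : ideleGroup ↥(maximalRealSubfield L), μ (AdeleRing.ideleBaseChange ↥(maximalRealSubfield L) L x) = quadraticHeckeCharCM L x)
      (_h2 : IsUnit (2 : 𝒪[w.1.adicCompletion L]))
      [MeasurableSpace ((UnitaryGroup.cmDatum L 3 (Matrix.of fun i j : Fin 3 => if i.val + j.val + 1 = 3 then (1 : L) else 0)).Local v)] [BorelSpace ((UnitaryGroup.cmDatum L 3 (Matrix.of fun i j : Fin 3 => if i.val + j.val + 1 = 3 then (1 : L) else 0)).Local v)]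
      [∀ γ : ((UnitaryGroup.cmDatum L 3 (Matrix.of fun i j : Fin 3 => if i.val + j.val + 1 = 3 then (1 : L) else 0)).Local v), MeasurableSpace (((UnitaryGroup.cmDatum L 3 (Matrix.of fun i j : Fin 3 => if i.val + j.val + 1 = 3 then (1 : L) else 0)).Local v) ⧸ Subgroup.centralizer ({γ} : Set ((UnitaryGroup.cmDatum L 3 (Matrix.of fun i j : Fin 3 => if i.val + j.val + 1 = 3 then (1 : L) else 0)).Local v)))]
      [∀ γ : ((UnitaryGroup.cmDatum L 3 (Matrix.of fun i j : Fin 3 => if i.val + j.val + 1 = 3 then (1 : L) else 0)).Local v), BorelSpace (((UnitaryGroup.cmDatum L 3 (Matrix.of fun i j : Fin 3 => if i.val + j.val + 1 = 3 then (1 : L) else 0)).Local v) ⧸ Subgroup.centralizer ({γ} : Set ((UnitaryGroup.cmDatum L 3 (Matrix.of fun i j : Fin 3 => if i.val + j.val + 1 = 3 then (1 : L) else 0)).Local v)))]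
      [MeasurableSpace ((UnitaryGroup.cmDatum L 2 (Matrix.of fun i j : Fin 2 => if i.val + j.val + 1 = 2 then (1 : L) else 0)).Local v × (UnitaryGroup.cmDatum L 1 (Matrix.of fun i j : Fin 1 => if i.val + j.val + 1 = 1 then (1 : L) else 0)).Local v)] [BorelSpace ((UnitaryGroup.cmDatum L 2 (Matrix.of fun i j : Fin 2 => if i.val + j.val + 1 = 2 then (1 : L) else 0)).Local v × (UnitaryGroup.cmDatum L 1 (Matrix.of fun i j : Fin 1 => if i.val + j.val + 1 = 1 then (1 : L) else 0)).Local v)]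
      [∀ a : ((UnitaryGroup.cmDatum L 2 (Matrix.of fun i j : Fin 2 => if i.val + j.val + 1 = 2 then (1 : L) else 0)).Local v × (UnitaryGroup.cmDatum L 1 (Matrix.of fun i j : Fin 1 => if i.val + j.val + 1 = 1 then (1 : L) else 0)).Local v), MeasurableSpace (((UnitaryGroup.cmDatum L 2 (Matrix.of fun i j : Fin 2 => if i.val + j.val + 1 = 2 then (1 : L) else 0)).Local v × (UnitaryGroup.cmDatum L 1 (Matrix.of fun i j : Fin 1 => if i.val + j.val + 1 = 1 then (1 : L) else 0)).Local v) ⧸ Subgroup.centralizer ({a} : Set ((UnitaryGroup.cmDatum L 2 (Matrix.of fun i j : Fin 2 => if i.val + j.val + 1 = 2 then (1 : L) else 0)).Local v × (UnitaryGroup.cmDatum L 1 (Matrix.of fun i j : Fin 1 => if i.val + j.val + 1 = 1 then (1 : L) else 0)).Local v)))]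
      [∀ a : ((UnitaryGroup.cmDatum L 2 (Matrix.of fun i j : Fin 2 => if i.val + j.val + 1 = 2 then (1 : L) else 0)).Local v × (UnitaryGroup.cmDatum L 1 (Matrix.of fun i j : Fin 1 => if i.val + j.val + 1 = 1 then (1 : L) else 0)).Local v), BorelSpace (((UnitaryGroup.cmDatum L 2 (Matrix.of fun i j : Fin 2 => if i.val + j.val + 1 = 2 then (1 : L) else 0)).Local v × (UnitaryGroup.cmDatum L 1 (Matrix.of fun i j : Fin 1 => if i.val + j.val + 1 = 1 then (1 : L) else 0)).Local v) ⧸ Subgroup.centralizer ({a} : Set ((UnitaryGroup.cmDatum L 2 (Matrix.of fun i j : Fin 2 => if i.val + j.val + 1 = 2 then (1 : L) else 0)).Local v × (UnitaryGroup.cmDatum L 1 (Matrix.of fun i j : Fin 1 => if i.val + j.val + 1 = 1 then (1 : L) else 0)).Local v)))]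
      (νH : Measure ((UnitaryGroup.cmDatum L 2 (Matrix.of fun i j : Fin 2 => if i.val + j.val + 1 = 2 then (1 : L) else 0)).Local v × (UnitaryGroup.cmDatum L 1 (Matrix.of fun i j : Fin 1 => if i.val + j.val + 1 = 1 then (1 : L) else 0)).Local v)) [νH.IsHaarMeasure] [νH.IsMulRightInvariant]
      (νG₃ : Measure ((UnitaryGroup.cmDatum L 3 (Matrix.of fun i j : Fin 3 => if i.val + j.val + 1 = 3 then (1 : L) else 0)).Local v)) [νG₃.IsHaarMeasure] [νG₃.IsMulRightInvariant]
      {mH : OrbitalMeasureFamily ((UnitaryGroup.cmDatum L 2 (Matrix.of fun i j : Fin 2 => if i.val + j.val + 1 = 2 then (1 : L) else 0)).Local v × (UnitaryGroup.cmDatum L 1 (Matrix.of fun i j : Fin 1 => if i.val + j.val + 1 = 1 then (1 : L) else 0)).Local v)} {mG₃ : OrbitalMeasureFamily ((UnitaryGroup.cmDatum L 3 (Matrix.of fun i j : Fin 3 => if i.val + j.val + 1 = 3 then (1 : L) else 0)).Local v)},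
      mH.IsCanonical (IsLocalGRegular L v) νH → mG₃.IsCanonical (fun γ => IsRegularElt (γ.val : GL (Fin 3) (UnitaryGroup.LocalRing L v))) νG₃ →
      ShalikaGermExpansionNonsplit L (Matrix.of fun i j : Fin 3 => if i.val + j.val + 1 = 3 then (1 : L) else 0) v →
      ∀ (φ₃ : ((UnitaryGroup.cmDatum L 3 (Matrix.of fun i j : Fin 3 => if i.val + j.val + 1 = 3 then (1 : L) else 0)).Local v) → ℂ), IsLocSmooth φ₃ →
        ∃ V ∈ 𝓝 (1 : ((UnitaryGroup.cmDatum L 2 (Matrix.of fun i j : Fin 2 => if i.val + j.val + 1 = 2 then (1 : L) else 0)).Local v × (UnitaryGroup.cmDatum L 1 (Matrix.of fun i j : Fin 1 => if i.val + j.val + 1 = 1 then (1 : L) else 0)).Local v)), ∃ φH : ((UnitaryGroup.cmDatum L 2 (Matrix.of fun i j : Fin 2 => if i.val + j.val + 1 = 2 then (1 : L) else 0)).Local v × (UnitaryGroup.cmDatum L 1 (Matrix.of fun i j : Fin 1 => if i.val + j.val + 1 = 1 then (1 : L) else 0)).Local v) → ℂ, IsLocSmooth φH ∧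
          ∀ γH ∈ V, IsLocalGRegular L v γH →
            stableOrbitalIntegralRel (IsLocalStablyConjH L v) mH φH γH =
              ∑ᶠ c : ConjClasses ((UnitaryGroup.cmDatum L 3 (Matrix.of fun i j : Fin 3 => if i.val + j.val + 1 = 3 then (1 : L) else 0)).Local v), ((finExplicitCollection L (Matrix.of fun i j : Fin 3 => if i.val + j.val + 1 = 3 then (1 : L) else 0) μ (finExplicitDelta_conj_left_all L (Matrix.of fun i j : Fin 3 => if i.val + j.val + 1 = 3 then (1 : L) else 0) μ) (finExplicitDelta_conj_right_all L (Matrix.of fun i j : Fin 3 => if i.val + j.val + 1 = 3 then (1 : L) else 0) μ)) v).Δ γH (Quotient.out c) * classOrbitalIntegral mG₃ φ₃ c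

/-- Unfolding `N6nsS3ramStatement` (by `Iff.rfl`). [cite: Rogawski1990, §4.9 Prop. 4.9.1 (a) p. 55] -/
theorem n6nsS3ramStatement_iff :
    N6nsS3ramStatement ↔
    ∀ (L : Type) [Field L] [NumberField L] [IsCMField L] (μ : HeckeCharacter L)
      {v : HeightOneSpectrum (𝓞 ↥(maximalRealSubfield L))} (w : UnitaryGroup.PlacesOver L v)
      (_hw : IsCMField.complexConj L • w.1 = w.1) (_he : v.asIdeal.ramificationIdx' w.1.asIdeal ≠ 1)
      (_hμu : μ.IsUnitary)
      (_hμω : ∀ x : ideleGroup ↥(maximalRealSubfield L), μ (AdeleRing.ideleBaseChange ↥(maximalRealSubfield L) L x) = quadraticHeckeCharCM L x)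
      (_h2 : IsUnit (2 : 𝒪[w.1.adicCompletion L]))
      [MeasurableSpace ((UnitaryGroup.cmDatum L 3 (Matrix.of fun i j : Fin 3 => if i.val + j.val + 1 = 3 then (1 : L) else 0)).Local v)] [BorelSpace ((UnitaryGroup.cmDatum L 3 (Matrix.of fun i j : Fin 3 => if i.val + j.val + 1 = 3 then (1 : L) else 0)).Local v)]
      [∀ γ : ((UnitaryGroup.cmDatum L 3 (Matrix.of fun i j : Fin 3 => if i.val + j.val + 1 = 3 then (1 : L) else 0)).Local v), MeasurableSpace (((UnitaryGroup.cmDatum L 3 (Matrix.of fun i j : Fin 3 => if i.val + j.val + 1 = 3 then (1 : L) else 0)).Local v) ⧸ Subgroup.centralizer ({γ} : Set ((UnitaryGroup.cmDatum L 3 (Matrix.of fun i j : Fin 3 => if i.val + j.val + 1 = 3 then (1 : L) else 0)).Local v)))]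
      [∀ γ : ((UnitaryGroup.cmDatum L 3 (Matrix.of fun i j : Fin 3 => if i.val + j.val + 1 = 3 then (1 : L) else 0)).Local v), BorelSpace (((UnitaryGroup.cmDatum L 3 (Matrix.of fun i j : Fin 3 => if i.val + j.val + 1 = 3 then (1 : L) else 0)).Local v) ⧸ Subgroup.centralizer ({γ} : Set ((UnitaryGroup.cmDatum L 3 (Matrix.of fun i j : Fin 3 => if i.val + j.val + 1 = 3 then (1 : L) else 0)).Local v)))]
      [MeasurableSpace ((UnitaryGroup.cmDatum L 2 (Matrix.of fun i j : Fin 2 => if i.val + j.val + 1 = 2 then (1 : L) else 0)).Local v × (UnitaryGroup.cmDatum L 1 (Matrix.of fun i j : Fin 1 => if i.val + j.val + 1 = 1 then (1 : L) else 0)).Local v)] [BorelSpace ((UnitaryGroup.cmDatum L 2 (Matrix.of fun i j : Fin 2 => if i.val + j.val + 1 = 2 then (1 : L) else 0)).Local v × (UnitaryGroup.cmDatum L 1 (Matrix.of fun i j : Fin 1 => if i.val + j.val + 1 = 1 then (1 : L) else 0)).Local v)]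
      [∀ a : ((UnitaryGroup.cmDatum L 2 (Matrix.of fun i j : Fin 2 => if i.val + j.val + 1 = 2 then (1 : L) else 0)).Local v × (UnitaryGroup.cmDatum L 1 (Matrix.of fun i j : Fin 1 => if i.val + j.val + 1 = 1 then (1 : L) else 0)).Local v), MeasurableSpace (((UnitaryGroup.cmDatum L 2 (Matrix.of fun i j : Fin 2 => if i.val + j.val + 1 = 2 then (1 : L) else 0)).Local v × (UnitaryGroup.cmDatum L 1 (Matrix.of fun i j : Fin 1 => if i.val + j.val + 1 = 1 then (1 : L) else 0)).Local v) ⧸ Subgroup.centralizer ({a} : Set ((UnitaryGroup.cmDatum L 2 (Matrix.of fun i j : Fin 2 => if i.val + j.val + 1 = 2 then (1 : L) else 0)).Local v × (UnitaryGroup.cmDatum L 1 (Matrix.of fun i j : Fin 1 => if i.val + j.val + 1 = 1 then (1 : L) else 0)).Local v)))]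
      [∀ a : ((UnitaryGroup.cmDatum L 2 (Matrix.of fun i j : Fin 2 => if i.val + j.val + 1 = 2 then (1 : L) else 0)).Local v × (UnitaryGroup.cmDatum L 1 (Matrix.of fun i j : Fin 1 => if i.val + j.val + 1 = 1 then (1 : L) else 0)).Local v), BorelSpace (((UnitaryGroup.cmDatum L 2 (Matrix.of fun i j : Fin 2 => if i.val + j.val + 1 = 2 then (1 : L) else 0)).Local v × (UnitaryGroup.cmDatum L 1 (Matrix.of fun i j : Fin 1 => if i.val + j.val + 1 = 1 then (1 : L) else 0)).Local v) ⧸ Subgroup.centralizer ({a} : Set ((UnitaryGroup.cmDatum L 2 (Matrix.of fun i j : Fin 2 => if i.val + j.val + 1 = 2 then (1 : L) else 0)).Local v × (UnitaryGroup.cmDatum L 1 (Matrix.of fun i j : Fin 1 => if i.val + j.val + 1 = 1 then (1 : L) else 0)).Local v)))]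
      (νH : Measure ((UnitaryGroup.cmDatum L 2 (Matrix.of fun i j : Fin 2 => if i.val + j.val + 1 = 2 then (1 : L) else 0)).Local v × (UnitaryGroup.cmDatum L 1 (Matrix.of fun i j : Fin 1 => if i.val + j.val + 1 = 1 then (1 : L) else 0)).Local v)) [νH.IsHaarMeasure] [νH.IsMulRightInvariant]
      (νG₃ : Measure ((UnitaryGroup.cmDatum L 3 (Matrix.of fun i j : Fin 3 => if i.val + j.val + 1 = 3 then (1 : L) else 0)).Local v)) [νG₃.IsHaarMeasure] [νG₃.IsMulRightInvariant]
      {mH : OrbitalMeasureFamily ((UnitaryGroup.cmDatum L 2 (Matrix.of fun i j : Fin 2 => if i.val + j.val + 1 = 2 then (1 : L) else 0)).Local v × (UnitaryGroup.cmDatum L 1 (Matrix.of fun i j : Fin 1 => if i.val + j.val + 1 = 1 then (1 : L) else 0)).Local v)} {mG₃ : OrbitalMeasureFamily ((UnitaryGroup.cmDatum L 3 (Matrix.of fun i j : Fin 3 => if i.val + j.val + 1 = 3 then (1 : L) else 0)).Local v)},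
      mH.IsCanonical (IsLocalGRegular L v) νH → mG₃.IsCanonical (fun γ => IsRegularElt (γ.val : GL (Fin 3) (UnitaryGroup.LocalRing L v))) νG₃ →
      ShalikaGermExpansionNonsplit L (Matrix.of fun i j : Fin 3 => if i.val + j.val + 1 = 3 then (1 : L) else 0) v →
      ∀ (φ₃ : ((UnitaryGroup.cmDatum L 3 (Matrix.of fun i j : Fin 3 => if i.val + j.val + 1 = 3 then (1 : L) else 0)).Local v) → ℂ), IsLocSmooth φ₃ →
        ∃ V ∈ 𝓝 (1 : ((UnitaryGroup.cmDatum L 2 (Matrix.of fun i j : Fin 2 => if i.val + j.val + 1 = 2 then (1 : L) else 0)).Local v × (UnitaryGroup.cmDatum L 1 (Matrix.of fun i j : Fin 1 => if i.val + j.val + 1 = 1 then (1 : L) else 0)).Local v)), ∃ φH : ((UnitaryGroup.cmDatum L 2 (Matrix.of fun i j : Fin 2 => if i.val + j.val + 1 = 2 then (1 : L) else 0)).Local v × (UnitaryGroup.cmDatum L 1 (Matrix.of fun i j : Fin 1 => if i.val + j.val + 1 = 1 then (1 : L) else 0)).Local v) → ℂ, IsLocSmooth φH ∧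
          ∀ γH ∈ V, IsLocalGRegular L v γH →
            stableOrbitalIntegralRel (IsLocalStablyConjH L v) mH φH γH =
              ∑ᶠ c : ConjClasses ((UnitaryGroup.cmDatum L 3 (Matrix.of fun i j : Fin 3 => if i.val + j.val + 1 = 3 then (1 : L) else 0)).Local v), ((finExplicitCollection L (Matrix.of fun i j : Fin 3 => if i.val + j.val + 1 = 3 then (1 : L) else 0) μ (finExplicitDelta_conj_left_all L (Matrix.of fun i j : Fin 3 => if i.val + j.val + 1 = 3 then (1 : L) else 0) μ) (finExplicitDelta_conj_right_all L (Matrix.of fun i j : Fin 3 => if i.val + j.val + 1 = 3 then (1 : L) else 0) μ)) v).Δ γH (Quotient.out c) * classOrbitalIntegral mG₃ φ₃ c :=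
  Iff.rfl

/-- **«DYADIC» — the identity core of local `Δ‴_v`-transfer for `(U(3), U(1,1) × U(1))` at a DYADIC non-split place** (= the `hdy` binder of ★
`n6nsS3id_of_tameRamAntidiag_of_dyadic_of_shalikaAntidiag` byte-for-byte = the germ's `stub_N6nsS3id` text with the extra hypothesis `∀ w ∣ v, ¬ IsUnit (2 : 𝒪_w)`): for a CM
field `L`, `H′ ∈ M₃(L)` hermitian anisotropic, `μ` unitary with the μ-guard, Borel σ-algebras and Haar measures, a non-split DYADIC `v`, CANONICAL families `mH`, `mG`: every
`φ ∈ C_c^∞(G′_v)` admits `V ∈ 𝓝 1` and `φH ∈ C_c^∞(H_v)` with `SO_{γH}(φH) = Σ_c Δ‴_v(γH, c)·O_c(φ)` for all `G`-regular `γH ∈ V`.  PERMANENT PRINT residual: [LS₂] at `v ∣ 2`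
(Langlands–Shelstad transfer for type `A₂`, «(G′_v, H_v) admits local Δ-transfer at the identity»).
[cite: LanglandsShelstad1990Descent, §2.1 (2.1.2)] [cite: Rogawski1990, §4.9 Prop. 4.9.1 (a) p. 55] [cite: LanglandsShelstad1989, Theorem (end of §2, p. 484)] -/
def N6nsDyadicStatement : Prop :=
    ∀ (L : Type) [Field L] [NumberField L] [IsCMField L] (H' : Matrix (Fin 3) (Fin 3) L) (μ : HeckeCharacter L)
      [∀ v : HeightOneSpectrum (𝓞 ↥(maximalRealSubfield L)),
        MeasurableSpace ((UnitaryGroup.cmDatum L 2 (Matrix.of fun i j : Fin 2 => if i.val + j.val + 1 = 2 then (1 : L) else 0)).Local v ×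
          (UnitaryGroup.cmDatum L 1 (Matrix.of fun i j : Fin 1 => if i.val + j.val + 1 = 1 then (1 : L) else 0)).Local v)]
      [∀ v : HeightOneSpectrum (𝓞 ↥(maximalRealSubfield L)),
        BorelSpace ((UnitaryGroup.cmDatum L 2 (Matrix.of fun i j : Fin 2 => if i.val + j.val + 1 = 2 then (1 : L) else 0)).Local v ×
          (UnitaryGroup.cmDatum L 1 (Matrix.of fun i j : Fin 1 => if i.val + j.val + 1 = 1 then (1 : L) else 0)).Local v)]
      [∀ v : HeightOneSpectrum (𝓞 ↥(maximalRealSubfield L)), MeasurableSpace ((UnitaryGroup.cmDatum L 3 H').Local v)]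
      [∀ v : HeightOneSpectrum (𝓞 ↥(maximalRealSubfield L)), BorelSpace ((UnitaryGroup.cmDatum L 3 H').Local v)]
      (νH : ∀ v : HeightOneSpectrum (𝓞 ↥(maximalRealSubfield L)),
        Measure ((UnitaryGroup.cmDatum L 2 (Matrix.of fun i j : Fin 2 => if i.val + j.val + 1 = 2 then (1 : L) else 0)).Local v ×
          (UnitaryGroup.cmDatum L 1 (Matrix.of fun i j : Fin 1 => if i.val + j.val + 1 = 1 then (1 : L) else 0)).Local v))
      (νG : ∀ v : HeightOneSpectrum (𝓞 ↥(maximalRealSubfield L)), Measure ((UnitaryGroup.cmDatum L 3 H').Local v))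
      [∀ v, (νH v).IsHaarMeasure] [∀ v, (νH v).IsMulRightInvariant] [∀ v, (νG v).IsHaarMeasure] [∀ v, (νG v).IsMulRightInvariant],
      μ.IsUnitary →
      (∀ x : ideleGroup ↥(maximalRealSubfield L), μ (AdeleRing.ideleBaseChange (↥(maximalRealSubfield L)) L x) = quadraticHeckeCharCM L x) →
      (H'.map (cmConjRingHom L)).transpose = H' →
      (∀ x : Fin 3 → L, Literature.AlgebraicGeometry.ShimuraVarieties.hermForm (cmConjRingHom L) H' x x = 0 → x = 0) →
      ∀ (v : HeightOneSpectrum (𝓞 ↥(maximalRealSubfield L))), Subsingleton (UnitaryGroup.PlacesOver L v) →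
      -- ── AT A DYADIC NON-SPLIT PLACE `v` (the permanent print residual) ──
      (∀ w : UnitaryGroup.PlacesOver L v, ¬ IsUnit (2 : 𝒪[w.1.adicCompletion L])) →
      ∀ [_iH : ∀ a : ((UnitaryGroup.cmDatum L 2 (Matrix.of fun i j : Fin 2 => if i.val + j.val + 1 = 2 then (1 : L) else 0)).Local v × (UnitaryGroup.cmDatum L 1 (Matrix.of fun i j : Fin 1 => if i.val + j.val + 1 = 1 then (1 : L) else 0)).Local v),
          MeasurableSpace (((UnitaryGroup.cmDatum L 2 (Matrix.of fun i j : Fin 2 => if i.val + j.val + 1 = 2 then (1 : L) else 0)).Local v × (UnitaryGroup.cmDatum L 1 (Matrix.of fun i j : Fin 1 => if i.val + j.val + 1 = 1 then (1 : L) else 0)).Local v) ⧸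
            Subgroup.centralizer ({a} : Set ((UnitaryGroup.cmDatum L 2 (Matrix.of fun i j : Fin 2 => if i.val + j.val + 1 = 2 then (1 : L) else 0)).Local v × (UnitaryGroup.cmDatum L 1 (Matrix.of fun i j : Fin 1 => if i.val + j.val + 1 = 1 then (1 : L) else 0)).Local v)))]
        [_bH : ∀ a : ((UnitaryGroup.cmDatum L 2 (Matrix.of fun i j : Fin 2 => if i.val + j.val + 1 = 2 then (1 : L) else 0)).Local v × (UnitaryGroup.cmDatum L 1 (Matrix.of fun i j : Fin 1 => if i.val + j.val + 1 = 1 then (1 : L) else 0)).Local v),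
          BorelSpace (((UnitaryGroup.cmDatum L 2 (Matrix.of fun i j : Fin 2 => if i.val + j.val + 1 = 2 then (1 : L) else 0)).Local v × (UnitaryGroup.cmDatum L 1 (Matrix.of fun i j : Fin 1 => if i.val + j.val + 1 = 1 then (1 : L) else 0)).Local v) ⧸
            Subgroup.centralizer ({a} : Set ((UnitaryGroup.cmDatum L 2 (Matrix.of fun i j : Fin 2 => if i.val + j.val + 1 = 2 then (1 : L) else 0)).Local v × (UnitaryGroup.cmDatum L 1 (Matrix.of fun i j : Fin 1 => if i.val + j.val + 1 = 1 then (1 : L) else 0)).Local v)))]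
        [_iG : ∀ γ : ((UnitaryGroup.cmDatum L 3 H').Local v), MeasurableSpace (((UnitaryGroup.cmDatum L 3 H').Local v) ⧸ Subgroup.centralizer ({γ} : Set ((UnitaryGroup.cmDatum L 3 H').Local v)))]
        [_bG : ∀ γ : ((UnitaryGroup.cmDatum L 3 H').Local v), BorelSpace (((UnitaryGroup.cmDatum L 3 H').Local v) ⧸ Subgroup.centralizer ({γ} : Set ((UnitaryGroup.cmDatum L 3 H').Local v)))]
        (mH : OrbitalMeasureFamily ((UnitaryGroup.cmDatum L 2 (Matrix.of fun i j : Fin 2 => if i.val + j.val + 1 = 2 then (1 : L) else 0)).Local v × (UnitaryGroup.cmDatum L 1 (Matrix.of fun i j : Fin 1 => if i.val + j.val + 1 = 1 then (1 : L) else 0)).Local v))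
        (mG : OrbitalMeasureFamily ((UnitaryGroup.cmDatum L 3 H').Local v)),
      mH.IsCanonical (IsLocalGRegular L v) (νH v) → mG.IsCanonical (fun γ => IsRegularElt (γ.val : GL (Fin 3) (UnitaryGroup.LocalRing L v))) (νG v) →
      ∀ (φ : ((UnitaryGroup.cmDatum L 3 H').Local v) → ℂ), IsLocSmooth φ →
        ∃ V ∈ 𝓝 (1 : ((UnitaryGroup.cmDatum L 2 (Matrix.of fun i j : Fin 2 => if i.val + j.val + 1 = 2 then (1 : L) else 0)).Local v × (UnitaryGroup.cmDatum L 1 (Matrix.of fun i j : Fin 1 => if i.val + j.val + 1 = 1 then (1 : L) else 0)).Local v)), ∃ φH : ((UnitaryGroup.cmDatum L 2 (Matrix.of fun i j : Fin 2 => if i.val + j.val + 1 = 2 then (1 : L) else 0)).Local v × (UnitaryGroup.cmDatum L 1 (Matrix.of fun i j : Fin 1 => if i.val + j.val + 1 = 1 then (1 : L) else 0)).Local v) → ℂ, IsLocSmooth φH ∧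
          ∀ γH ∈ V, IsLocalGRegular L v γH →
            stableOrbitalIntegralRel (IsLocalStablyConjH L v) mH φH γH =
              ∑ᶠ c : ConjClasses ((UnitaryGroup.cmDatum L 3 H').Local v), ((finExplicitCollection L H' μ (finExplicitDelta_conj_left_all L H' μ) (finExplicitDelta_conj_right_all L H' μ)) v).Δ γH (Quotient.out c) * classOrbitalIntegral mG φ c

/-- Unfolding `N6nsDyadicStatement` (by `Iff.rfl`). [cite: LanglandsShelstad1990Descent, §2.1 (2.1.2)] -/
theorem n6nsDyadicStatement_iff :
    N6nsDyadicStatement ↔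
    ∀ (L : Type) [Field L] [NumberField L] [IsCMField L] (H' : Matrix (Fin 3) (Fin 3) L) (μ : HeckeCharacter L)
      [∀ v : HeightOneSpectrum (𝓞 ↥(maximalRealSubfield L)),
        MeasurableSpace ((UnitaryGroup.cmDatum L 2 (Matrix.of fun i j : Fin 2 => if i.val + j.val + 1 = 2 then (1 : L) else 0)).Local v ×
          (UnitaryGroup.cmDatum L 1 (Matrix.of fun i j : Fin 1 => if i.val + j.val + 1 = 1 then (1 : L) else 0)).Local v)]
      [∀ v : HeightOneSpectrum (𝓞 ↥(maximalRealSubfield L)),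
        BorelSpace ((UnitaryGroup.cmDatum L 2 (Matrix.of fun i j : Fin 2 => if i.val + j.val + 1 = 2 then (1 : L) else 0)).Local v ×
          (UnitaryGroup.cmDatum L 1 (Matrix.of fun i j : Fin 1 => if i.val + j.val + 1 = 1 then (1 : L) else 0)).Local v)]
      [∀ v : HeightOneSpectrum (𝓞 ↥(maximalRealSubfield L)), MeasurableSpace ((UnitaryGroup.cmDatum L 3 H').Local v)]
      [∀ v : HeightOneSpectrum (𝓞 ↥(maximalRealSubfield L)), BorelSpace ((UnitaryGroup.cmDatum L 3 H').Local v)]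
      (νH : ∀ v : HeightOneSpectrum (𝓞 ↥(maximalRealSubfield L)),
        Measure ((UnitaryGroup.cmDatum L 2 (Matrix.of fun i j : Fin 2 => if i.val + j.val + 1 = 2 then (1 : L) else 0)).Local v ×
          (UnitaryGroup.cmDatum L 1 (Matrix.of fun i j : Fin 1 => if i.val + j.val + 1 = 1 then (1 : L) else 0)).Local v))
      (νG : ∀ v : HeightOneSpectrum (𝓞 ↥(maximalRealSubfield L)), Measure ((UnitaryGroup.cmDatum L 3 H').Local v))
      [∀ v, (νH v).IsHaarMeasure] [∀ v, (νH v).IsMulRightInvariant] [∀ v, (νG v).IsHaarMeasure] [∀ v, (νG v).IsMulRightInvariant],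
      μ.IsUnitary →
      (∀ x : ideleGroup ↥(maximalRealSubfield L), μ (AdeleRing.ideleBaseChange (↥(maximalRealSubfield L)) L x) = quadraticHeckeCharCM L x) →
      (H'.map (cmConjRingHom L)).transpose = H' →
      (∀ x : Fin 3 → L, Literature.AlgebraicGeometry.ShimuraVarieties.hermForm (cmConjRingHom L) H' x x = 0 → x = 0) →
      ∀ (v : HeightOneSpectrum (𝓞 ↥(maximalRealSubfield L))), Subsingleton (UnitaryGroup.PlacesOver L v) →
      -- ── AT A DYADIC NON-SPLIT PLACE `v` (the permanent print residual) ──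
      (∀ w : UnitaryGroup.PlacesOver L v, ¬ IsUnit (2 : 𝒪[w.1.adicCompletion L])) →
      ∀ [_iH : ∀ a : ((UnitaryGroup.cmDatum L 2 (Matrix.of fun i j : Fin 2 => if i.val + j.val + 1 = 2 then (1 : L) else 0)).Local v × (UnitaryGroup.cmDatum L 1 (Matrix.of fun i j : Fin 1 => if i.val + j.val + 1 = 1 then (1 : L) else 0)).Local v),
          MeasurableSpace (((UnitaryGroup.cmDatum L 2 (Matrix.of fun i j : Fin 2 => if i.val + j.val + 1 = 2 then (1 : L) else 0)).Local v × (UnitaryGroup.cmDatum L 1 (Matrix.of fun i j : Fin 1 => if i.val + j.val + 1 = 1 then (1 : L) else 0)).Local v) ⧸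
            Subgroup.centralizer ({a} : Set ((UnitaryGroup.cmDatum L 2 (Matrix.of fun i j : Fin 2 => if i.val + j.val + 1 = 2 then (1 : L) else 0)).Local v × (UnitaryGroup.cmDatum L 1 (Matrix.of fun i j : Fin 1 => if i.val + j.val + 1 = 1 then (1 : L) else 0)).Local v)))]
        [_bH : ∀ a : ((UnitaryGroup.cmDatum L 2 (Matrix.of fun i j : Fin 2 => if i.val + j.val + 1 = 2 then (1 : L) else 0)).Local v × (UnitaryGroup.cmDatum L 1 (Matrix.of fun i j : Fin 1 => if i.val + j.val + 1 = 1 then (1 : L) else 0)).Local v),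
          BorelSpace (((UnitaryGroup.cmDatum L 2 (Matrix.of fun i j : Fin 2 => if i.val + j.val + 1 = 2 then (1 : L) else 0)).Local v × (UnitaryGroup.cmDatum L 1 (Matrix.of fun i j : Fin 1 => if i.val + j.val + 1 = 1 then (1 : L) else 0)).Local v) ⧸
            Subgroup.centralizer ({a} : Set ((UnitaryGroup.cmDatum L 2 (Matrix.of fun i j : Fin 2 => if i.val + j.val + 1 = 2 then (1 : L) else 0)).Local v × (UnitaryGroup.cmDatum L 1 (Matrix.of fun i j : Fin 1 => if i.val + j.val + 1 = 1 then (1 : L) else 0)).Local v)))]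
        [_iG : ∀ γ : ((UnitaryGroup.cmDatum L 3 H').Local v), MeasurableSpace (((UnitaryGroup.cmDatum L 3 H').Local v) ⧸ Subgroup.centralizer ({γ} : Set ((UnitaryGroup.cmDatum L 3 H').Local v)))]
        [_bG : ∀ γ : ((UnitaryGroup.cmDatum L 3 H').Local v), BorelSpace (((UnitaryGroup.cmDatum L 3 H').Local v) ⧸ Subgroup.centralizer ({γ} : Set ((UnitaryGroup.cmDatum L 3 H').Local v)))]
        (mH : OrbitalMeasureFamily ((UnitaryGroup.cmDatum L 2 (Matrix.of fun i j : Fin 2 => if i.val + j.val + 1 = 2 then (1 : L) else 0)).Local v × (UnitaryGroup.cmDatum L 1 (Matrix.of fun i j : Fin 1 => if i.val + j.val + 1 = 1 then (1 : L) else 0)).Local v))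
        (mG : OrbitalMeasureFamily ((UnitaryGroup.cmDatum L 3 H').Local v)),
      mH.IsCanonical (IsLocalGRegular L v) (νH v) → mG.IsCanonical (fun γ => IsRegularElt (γ.val : GL (Fin 3) (UnitaryGroup.LocalRing L v))) (νG v) →
      ∀ (φ : ((UnitaryGroup.cmDatum L 3 H').Local v) → ℂ), IsLocSmooth φ →
        ∃ V ∈ 𝓝 (1 : ((UnitaryGroup.cmDatum L 2 (Matrix.of fun i j : Fin 2 => if i.val + j.val + 1 = 2 then (1 : L) else 0)).Local v × (UnitaryGroup.cmDatum L 1 (Matrix.of fun i j : Fin 1 => if i.val + j.val + 1 = 1 then (1 : L) else 0)).Local v)), ∃ φH : ((UnitaryGroup.cmDatum L 2 (Matrix.of fun i j : Fin 2 => if i.val + j.val + 1 = 2 then (1 : L) else 0)).Local v × (UnitaryGroup.cmDatum L 1 (Matrix.of fun i j : Fin 1 => if i.val + j.val + 1 = 1 then (1 : L) else 0)).Local v) → ℂ, IsLocSmooth φH ∧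
          ∀ γH ∈ V, IsLocalGRegular L v γH →
            stableOrbitalIntegralRel (IsLocalStablyConjH L v) mH φH γH =
              ∑ᶠ c : ConjClasses ((UnitaryGroup.cmDatum L 3 H').Local v), ((finExplicitCollection L H' μ (finExplicitDelta_conj_left_all L H' μ) (finExplicitDelta_conj_right_all L H' μ)) v).Δ γH (Quotient.out c) * classOrbitalIntegral mG φ c :=
  Iff.rfl

/-- **«SHALIKA AT `Φ₃`» — the Shalika germ expansion at the identity for the quasi-split `U(Φ₃)(L⁺_v)` at every NON-SPLIT place `v`** (= the `hsh` binder of ★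
`n6nsS3id_of_tameRamAntidiag_of_dyadic_of_shalikaAntidiag` byte-for-byte = ★ def `ShalikaGermExpansionNonsplit L Φ₃ v` under `Subsingleton (PlacesOver L v)`): germs `Γ_u`
indexed by finitely many unipotent classes, independent of `f`, with `Φ(c, f) = Σ_u Φ(u, f)·Γ_u(c)` for the regular classes `c` near `1`.  PRINT: Harish-Chandra ∕ Shalika ∕
Ranga Rao as [Rogawski1990 Prop. 8.1.1] (printed scope: any p-adic field `F`, no parity proviso).
[cite: Rogawski1990, §8.1 Prop. 8.1.1 p. 112] [cite: HarishChandra1999AdmissibleDistributions, Thm. 8.1 p. 48] -/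
def N6nsShalikaStatement : Prop :=
    ∀ (L : Type) [Field L] [NumberField L] [IsCMField L] (v : HeightOneSpectrum (𝓞 ↥(maximalRealSubfield L))),
      Subsingleton (UnitaryGroup.PlacesOver L v) → ShalikaGermExpansionNonsplit L (Matrix.of fun i j : Fin 3 => if i.val + j.val + 1 = 3 then (1 : L) else 0) v

/-- Unfolding `N6nsShalikaStatement` (by `Iff.rfl`). [cite: Rogawski1990, §8.1 Prop. 8.1.1 p. 112] -/
theorem n6nsShalikaStatement_iff :
    N6nsShalikaStatement ↔
    ∀ (L : Type) [Field L] [NumberField L] [IsCMField L] (v : HeightOneSpectrum (𝓞 ↥(maximalRealSubfield L))),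
      Subsingleton (UnitaryGroup.PlacesOver L v) → ShalikaGermExpansionNonsplit L (Matrix.of fun i j : Fin 3 => if i.val + j.val + 1 = 3 then (1 : L) else 0) v :=
  Iff.rfl

end Literature.NumberTheory.Rogawski1990
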